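import Literature.AlgebraicGeometry.HodgeTheory.CyclicCoverPencilFoldHypotheses
import Literature.Geometry.Manifold.DiscFoldRotationIsotopy
import HarnessLib

/-!
# The fold isotopy of the nodal pencil on `𝒴°(ℂ)`

Family `hodge`, layer `Literature/AlgebraicGeometry/HodgeTheory`; step A3a of the programme discharging
`HodgeTheory/CyclicCoverNodalMeridianLocalMonodromyBound`: the instantiation of the abstract fold isotopy
`Geometry/Manifold/DiscFoldRotationIsotopy.exists_rotationIsotopy_of_folds` with the two complete cut-off monodromy flows `θ₁, θ₂`
(`CyclicCoverPencilCutoffFlows.exists_cutoff_globalFlow`) of the shell-tangent lifts (`CyclicCoverPencilShellFields.exists_shell_tangent_lift`)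
of two coefficient fields `W₁, W₂` pointing along `−e_{x₂^p}` resp. `−i·e_{x₂^p}` near `b₀`, the invariant set `A` and the pencil coordinate
(`CyclicCoverPencilShellInvariance`), and the fold hypotheses `h₁, h₂` (`CyclicCoverPencilFoldHypotheses.fold_hypothesis_of_flow`).

* `exists_pencil_foldIsotopy` — **a continuous `g : ℝ × 𝒴°(ℂ) → 𝒴°(ℂ)`, `g₀ = id = g_{2π}`, which on `A ∩ {|c| < ρW}` preserves `A`, rotates
  the pencil coordinate (`c(g(θ, q)) = e^{iθ} c(q)`) and satisfies the group law.**

Everything is proved; no definitions, no named facts (the remaining inputs — radii, bumps, the Lipschitz bounds — are explicit hypotheses,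
discharged by the final choice of constants).

## References

* [ArnoldGuseinzadeVarchenko2012] V. I. Arnold, S. M. Gusein-Zade, A. N. Varchenko, Singularities of Differentiable Maps II (2012), Part I §1.1, §2.1.
* [BrockerJanichIDT1982] T. Bröcker, K. Jänich, Introduction to Differential Topology (1982), (8.12).
-/

noncomputable section

open CategoryTheory AlgebraicGeometry MvPolynomial TopologicalSpace Set Topology Filter Complex
open scoped Manifold ContDiff Real
open Literature.AlgebraicGeometry.Motives Literature.AlgebraicGeometry.Motives.UniversalHypersurface
open Literature.AlgebraicGeometry.HodgeTheory.UniversalHypersurface Literature.Geometry.ComplexAnalytic Literature.Geometry.Manifold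

namespace Literature.AlgebraicGeometry.HodgeTheory

/-- **The fold isotopy of the nodal pencil.** [cite: ArnoldGuseinzadeVarchenko2012, Part I §2.1] [cite: BrockerJanichIDT1982, (8.12)] -/
theorem exists_pencil_foldIsotopy {p : ℕ} (hp : 3 ≤ p)
    {Θ : OpenPartialHomeomorph (Fin (1 + 2) → ℂ) (Fin (1 + 2) → ℂ)}
    (hΘ : ContDiffOn ℝ ∞ Θ Θ.source) (hΘs : ContDiffOn ℝ ∞ Θ.symm Θ.target)
    (hΘφ : ∀ x ∈ Θ.source, ∑ i, (Θ x) i ^ PhamBrieskorn.cyclicNodeExponents p i = x 2 ^ p - (x 0 * x 1 + x 0 ^ p + x 1 ^ p))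
    {s₀ s₁ r₂ δ R''' R'' : ℝ} (hs₀ : 0 < s₀) (hsr : s₀ ≤ r₂) (hr₂ : r₂ < 1) (hr₂' : r₂ ^ (p - 2) < 2 / p)
    (hs₀₁ : s₀ ^ 2 < s₁ ^ 2) (hs₁r : s₁ ^ 2 < r₂ ^ 2) (hr : r₂ ^ 2 < R''') (hR : R''' < R'')
    (hR'' : {z : Fin (1 + 2) → ℂ | ∑ i, ‖z i‖ ^ 2 ≤ R''} ⊆ Θ.target) (hδ : δ < s₀ ^ p)
    (β : (Fin (2 + 1) → ℂ) → ℝ) (hβ : ContDiff ℝ ∞ β) {Rβ η : ℝ} (hβR : ∀ y, Rβ < ‖y‖ → β y = 0)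
    (hβ1 : ∀ y, ‖y‖ < η → β y = 1) (hβs : ∀ y, β y ≠ 0 → y ∈ Θ.source ∧ ∑ i, ‖Θ y i‖ ^ 2 < s₀ ^ 2)
    (χ' : (DegIndex 2 p → ℂ) → ℝ) (hχ : ContDiff ℝ ∞ χ')
    {K V : Set (DegIndex 2 p → ℂ)} (hK : IsCompact K) (hKV : K ⊆ V) (hχK0 : ∀ b, b ∉ K → χ' b = 0)
    (hV : ∀ P : ComplexPoints (totalSpaceOver ℂ 2 p),
      P ∉ Set.range (AlgPoints.map (regularToTotalSpaceOver ℂ 2 p) : ComplexPoints (regularTotal ℂ 2 p) → _) →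
        tCoeff ℂ 2 p P ∈ V → P ∈ nodeNbhd p η)
    {ρK ρW : ℝ}
    (hχK : ∀ b, χ' b ≠ 0 →
      ‖b - coeffsOf 2 p (cyclicCoverForm p (X 2 ^ (p - 2) * (X 0 * X 1) + X 0 ^ p + X 1 ^ p))‖ < ρK)
    (hρδ : ρK ≤ δ)
    (hχ1 : ∀ b, ‖b - coeffsOf 2 p (cyclicCoverForm p (X 2 ^ (p - 2) * (X 0 * X 1) + X 0 ^ p + X 1 ^ p))‖ < ρW → χ' b = 1)
    (W₁ W₂ : (DegIndex 2 p → ℂ) → (DegIndex 2 p → ℂ)) (hW₁ : ContDiff ℝ ∞ W₁) (hW₂ : ContDiff ℝ ∞ W₂)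
    (hW₁' : ∀ b (m : DegIndex 2 p), m ≠ regPowIndex 2 p 2 → W₁ b m = 0)
    (hW₂' : ∀ b (m : DegIndex 2 p), m ≠ regPowIndex 2 p 2 → W₂ b m = 0)
    (hW₁u : ∀ b, ‖b - coeffsOf 2 p (cyclicCoverForm p (X 2 ^ (p - 2) * (X 0 * X 1) + X 0 ^ p + X 1 ^ p))‖ < ρW →
      W₁ b (regPowIndex 2 p 2) = -1)
    (hW₂u : ∀ b, ‖b - coeffsOf 2 p (cyclicCoverForm p (X 2 ^ (p - 2) * (X 0 * X 1) + X 0 ^ p + X 1 ^ p))‖ < ρW →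
      W₂ b (regPowIndex 2 p 2) = -I)
    {K₁ K₂ : NNReal}
    (hv₁ : LipschitzWith K₁ (fun z : ℂ =>
      -((χ' (coeffsOf 2 p (cyclicCoverForm p (X 2 ^ (p - 2) * (X 0 * X 1) + X 0 ^ p + X 1 ^ p)) -
            Pi.single (regPowIndex 2 p 2) z) : ℂ) *
        W₁ (coeffsOf 2 p (cyclicCoverForm p (X 2 ^ (p - 2) * (X 0 * X 1) + X 0 ^ p + X 1 ^ p)) -
            Pi.single (regPowIndex 2 p 2) z) (regPowIndex 2 p 2))))
    (hv₂ : LipschitzWith K₂ (fun z : ℂ =>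
      -((χ' (coeffsOf 2 p (cyclicCoverForm p (X 2 ^ (p - 2) * (X 0 * X 1) + X 0 ^ p + X 1 ^ p)) -
            Pi.single (regPowIndex 2 p 2) z) : ℂ) *
        W₂ (coeffsOf 2 p (cyclicCoverForm p (X 2 ^ (p - 2) * (X 0 * X 1) + X 0 ^ p + X 1 ^ p)) -
            Pi.single (regPowIndex 2 p 2) z) (regPowIndex 2 p 2)))) :
    ∃ g : ℝ × ComplexPoints (regularTotal ℂ 2 p) → ComplexPoints (regularTotal ℂ 2 p),
      Continuous g ∧ (∀ q, g (0, q) = q) ∧ (∀ q, g (2 * π, q) = q) ∧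
      (∀ θ, ∀ q ∈ invariantSet p Θ R''' R'' s₁, ‖pencilCoord p q‖ < ρW →
        g (θ, q) ∈ invariantSet p Θ R''' R'' s₁ ∧ pencilCoord p (g (θ, q)) = Complex.exp (θ * I) * pencilCoord p q) ∧
      (∀ θ θ', ∀ q ∈ invariantSet p Θ R''' R'' s₁, ‖pencilCoord p q‖ < ρW → g (θ + θ', q) = g (θ, g (θ', q))) := by
  have hd : 0 < p := by omega
  haveI := locallyOfFiniteType_regularTotal_hom ℂ 2 p hd
  haveI := smoothOfRelativeDimension_regularTotal_hom ℂ 2 p hd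
  letI := ComplexPoints.chartedSpace (regularTotal ℂ 2 p) (2 + Fintype.card (DegIndex 2 p))
  haveI := ComplexPoints.isManifold_real (regularTotal ℂ 2 p) (2 + Fintype.card (DegIndex 2 p))
  -- the shell-tangent lifts
  obtain ⟨X₁, hX₁, hXW₁, hXK₁⟩ := exists_shell_tangent_lift p Θ s₀ r₂ δ hp hΘ hΘs hΘφ hs₀ hsr hr₂ hr₂' hr hR hR'' hδ hW₁
  obtain ⟨X₂, hX₂, hXW₂, hXK₂⟩ := exists_shell_tangent_lift p Θ s₀ r₂ δ hp hΘ hΘs hΘφ hs₀ hsr hr₂ hr₂' hr hR hR'' hδ hW₂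
  -- their cut-off flows
  obtain ⟨θ₁, hθ₁, h0₁, hadd₁, hint₁, -⟩ := exists_cutoff_globalFlow p β χ' hd hβ hβR hβ1 hχ hK hKV hχK0 hV X₁ hX₁
  obtain ⟨θ₂, hθ₂, h0₂, hadd₂, hint₂, -⟩ := exists_cutoff_globalFlow p β χ' hd hβ hβR hβ1 hχ hK hKV hχK0 hV X₂ hX₂
  -- continuity of the pencil coordinate
  have hpc : Continuous (pencilCoord p) := by
    have hc : Continuous fun Q : ComplexPoints (regularTotal ℂ 2 p) => regCoeff ℂ 2 p Q :=
      continuous_iff_continuousAt.mpr fun Q => (contMDiffAt_regCoeff 2 p hd Q).continuousAt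
    exact ((continuous_apply (regPowIndex 2 p 2)).comp hc).neg
  -- the fold hypotheses
  have h₁ : ∀ x ∈ invariantSet p Θ R''' R'' s₁, ∀ t : ℝ, (∀ s ∈ uIcc 0 t, ‖pencilCoord p x + s‖ < ρW) →
      ∀ s ∈ uIcc 0 t, θ₁ (s, x) ∈ invariantSet p Θ R''' R'' s₁ ∧ pencilCoord p (θ₁ (s, x)) = pencilCoord p x + s := by
    intro x hx t hseg s hs
    have hseg' : ∀ s ∈ uIcc 0 t, ‖pencilCoord p x + s • (1 : ℂ)‖ < ρW := fun s hs => by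
      rw [Complex.real_smul, mul_one]; exact hseg s hs
    have h := fold_hypothesis_of_flow hp β χ' X₁ hXW₁ hW₁' h0₁ hint₁ hR hr hχK hρδ hXK₁ hΘ hR'' hs₀₁ hs₁r hβs hχ1 hW₁u hv₁
      hx hseg' hs
    rw [Complex.real_smul, mul_one] at h
    exact h
  have h₂ : ∀ x ∈ invariantSet p Θ R''' R'' s₁, ∀ t : ℝ, (∀ s ∈ uIcc 0 t, ‖pencilCoord p x + s * I‖ < ρW) →
      ∀ s ∈ uIcc 0 t, θ₂ (s, x) ∈ invariantSet p Θ R''' R'' s₁ ∧ pencilCoord p (θ₂ (s, x)) = pencilCoord p x + s * I := by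
    intro x hx t hseg s hs
    have hseg' : ∀ s ∈ uIcc 0 t, ‖pencilCoord p x + s • I‖ < ρW := fun s hs => by
      rw [Complex.real_smul]; exact hseg s hs
    have h := fold_hypothesis_of_flow hp β χ' X₂ hXW₂ hW₂' h0₂ hint₂ hR hr hχK hρδ hXK₂ hΘ hR'' hs₀₁ hs₁r hβs hχ1 hW₂u hv₂
      hx hseg' hs
    rw [Complex.real_smul] at h
    exact h
  exact exists_rotationIsotopy_of_folds hpc hθ₁.continuous h0₁ hadd₁ hθ₂.continuous h0₂ hadd₂ h₁ h₂

end Literature.AlgebraicGeometry.HodgeTheory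

end
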